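import Summits.BirchSwinnertonDyer.BirchSwinnertonDyer.Theorems.GenusKolyvaginAtTwoPowDvdShaCardAtTwoRTExactSwapHybridFrob
import Summits.BirchSwinnertonDyer.BirchSwinnertonDyer.Theorems.KolyvaginRankRigidityAtTwoOppositeSignReciprocityKTerm
import Summits.BirchSwinnertonDyer.BirchSwinnertonDyer.Theorems.Rank1ResidualJetCompatibleData
import Summits.BirchSwinnertonDyer.BirchSwinnertonDyer.Theorems.GenusKolyvaginAtTwoShaCardDvdPowAtTwoRTNormSharpAtKolyvaginPlace
import HarnessLib

/-!
# Route `GenusKolyvaginAtTwo`, cruxes L_T `PowDvdShaCardAtTwoRT` (stmt-BirchSwinnertonDyer-23659) / U_T `ShaCardDvdPowAtTwoRT` (stmt-23658) —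
# KOLYVAGIN'S FIRST SELMER ANNIHILATION AT `2`, NORM-SHARP: `2^(M−g) • (z + w • τ_* z) = 0` for EVERY Selmer class `z` (no lost bit)

Seat `bsd-line-gk2-p5` g28 (cell `bsd-f1-sign2`), `--supports stmt-BirchSwinnertonDyer-23659` (helper; closes nothing).  THEOREMS ONLY
(no definition, no named fact, no `sorry`).  Twin of `…RTSelmerLayerOneCore` (p743233: the EIGEN form `2^(M+1−g) • z = 0` for a `(+w)`-eigen
Selmer class, via gk2-p3 g23's exact same-sign law P7a⁼) with the local step replaced by gk2-p3 g25's NORM-SHARP law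
(`two_pow_smul_localization_norm_eq_zero_of_invWeilPairing_eq_zero`, p741749): the global statement of gk2-p3's U_T memo §2
«`2^(M₀)·(1 + wτ)·Sel_(2^M)(E/K) = 0`», one bit sharper than the eigen form applied to `z + w • τ_* z`.  BSD is NOT proved by any of this;
neither is L_T, U_T, nor any stub.

* §1 `selmerLayerOne_core_norm` — frame currency of the LEAD's `exactSwap_core_frob` (P8/P4/Q2/T2 displayed) with the displayed NORM slot
  `hP7n` («at a Kolyvagin place of index `≥ M` with `Frob = Frob_∞`, for `w` Kummer and an `s`-eigen `C` of Kummer threshold `b`: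
  `⟨loc w, loc w_*C⟩ = 0 ⟹ 2^(M−b) • loc (w + s • τ_* w) = 0`»): for a conductor-`1` datum with `addOrderOf c_M(1) = 2^g`, (NPh_{M+k}) and ANY
  Selmer class `z`: **`2^(M−g) • (z + w • τ_* z) = 0`**.  Proof: if `y′ := 2^(M−g)(z + wτ_*z) ≠ 0`, the deep pair Čebotarev (p710403) on
  `(c_M(1), y′)` gives `ℓ` with `loc c_M(1)` of full order `2^g` and `loc y′ ≠ 0`; the one-term reciprocity for `(z, c_M(ℓ))` (KRR
  `sum_localTatePairing_eq_zero_of_dvd`) and Q2 at `ℓ` (threshold `g`) feed `hP7n`, which says `loc y′ = 0` — contradiction.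
* §2 `normLaw_sharp_at_two` — the slot `hP7n` DISCHARGED from p741749 (bridge: `invWeilPairing_apply`, `X11b.LocBridge.localTatePairingZMod_map_weilDual`,
  `galoisCohomology.res_map_one`, `conjActPlace_localization`, `weil_equivariant_of_isLiftOfAut`).
Sequel `…RTSelmerLayerOneNormAtTwo`: P8/P4/T2 discharged on the hybrid frame, the frame built inside, the `M₀`-currency
**`2^(M₀) • (s + w • τ_* s) = 0` for every `s ∈ Sel_{2^M}(E/K)`, `M ≥ M₀ + 1`**, and (NPh) discharged on the (D-NPh) habitat (modulo Q2 only).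

References: [GrossLMS1991] §8 Prop. 8.2, §10; [McCallumLMS1991] §5 (13), Lemma 5.3, Thm. 5.4; [Kolyvagin1991MathAnn] Thm. 2.1, §2 Thm. 2.2.
-/

set_option autoImplicit false
set_option linter.dupNamespace false

noncomputable section

open scoped Classical Pointwise
open Function NumberField IsDedekindDomain WeierstrassCurve Field
open Literature.NumberTheory.EllipticCurves Literature.NumberTheory.GaloisRepresentations
open Literature.NumberTheory.EllipticCurves.Jetchev2008 Literature.NumberTheory.EllipticCurves.ModularForms
open Literature.NumberTheory.GaloisCohomology
open Literature.NumberTheory.GaloisRepresentations.DiscreteGaloisModule (localTatePairingZMod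
  tateDual transverseSubgroup SelmerStructure)
open Literature.NumberTheory.Automorphic
open Summit.BirchSwinnertonDyer.Rank1Residual
open Summit.BirchSwinnertonDyer.Rank1Residual.JET.SelmerVocabulary
open Summit.BirchSwinnertonDyer.Rank1Residual.JET.GlobalDuality
open Summit.BirchSwinnertonDyer.BirchSwinnertonDyer.Theses.GenusKolyvaginAtTwo (KolyvaginRelationAtTwo)
open Summit.BirchSwinnertonDyer.BirchSwinnertonDyer.Theorems.KolyvaginLowerBoundAtTwo

namespace Summit.BirchSwinnertonDyer.BirchSwinnertonDyer.Theorems.GenusExact.PlusDescent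

open Summit.BirchSwinnertonDyer.Rank1Residual.X11b.Relaxation

/-! ## §1 The norm-sharp core -/

section Frame

variable {K : Type} [Field K] [NumberField K] (W : WeierstrassCurve ℚ) [W.IsElliptic]
  [W.IsGloballyMinimal] [(W.baseChange K).IsElliptic] [NeZero (W.conductorNorm ℤ)]
  [∀ M : ℕ, NeZero (2 ^ M)] [∀ M : ℕ, Finite (geomTorsion (W.baseChange K) ((2 ^ M : ℕ) : ℤ))]
  (τ : K ≃ₐ[ℚ] K)
  (Dt : ModularParametrizationData W (W.conductorNorm ℤ)) (β : ℤ) (ι : K →+* ℂ)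
  (e : ∀ M : ℕ, geomTorsion (W.baseChange K) ((2 ^ M : ℕ) : ℤ) →
    geomTorsion (W.baseChange K) ((2 ^ M : ℕ) : ℤ) → AlgebraicClosure K)
  (hμ : ∀ M S T, e M S T ^ (2 ^ M) = 1)
  (hadd₁ : ∀ M S₁ S₂ T, e M (S₁ + S₂) T = e M S₁ T * e M S₂ T)
  (hadd₂ : ∀ M S T₁ T₂, e M S (T₁ + T₂) = e M S T₁ * e M S T₂)
  (hgal : ∀ M (g : absoluteGaloisGroup K) (S T : geomTorsion (W.baseChange K) ((2 ^ M : ℕ) : ℤ)),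
    g • e M S T = e M (g • S) (g • T))
  (halt : ∀ M T, e M T T = 1) (hnondeg : ∀ M T, (∀ S, e M S T = 1) → T = 0)
  (inv : ∀ M : ℕ, LocalInvariants K (2 ^ M))
  (𝒯 : ∀ M : ℕ, SelmerStructure ((W.baseChange K).torsionGaloisModule ((2 ^ M : ℕ) : ℤ)))
  (hCM : ¬ W.HasCM) (hΔ : W.Δ < 0)
  (hsur : ∀ m : ℕ, W.HasSurjectiveModNGaloisRep (2 ^ m : ℕ)) (hK : IsImaginaryQuadratic K)
  (hodd : Odd (NumberField.discr K)) (hne3 : NumberField.discr K ≠ -3)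
  (hns : ¬ IsSquare ((NumberField.discr K : ℚ) * -|W.Δ|))
  (hHN : SatisfiesHeegnerHypothesis (W.conductorNorm ℤ) K)
  (hτ1 : τ ≠ 1)
  (hperf : ∀ M, (inv M).IsPerfect) (hvan : ∀ M, (inv M).SumLocalTermEqZero)
  (h𝒯sd : ∀ (M c : ℕ), ∀ v ∈ placesDividing K c,
    (inv M).dualTransported (𝒯 M) (weilDualIntertwining (W.baseChange K) (2 ^ M) (e M) (hμ M) (hadd₁ M)
      (hadd₂ M) (hgal M)) (Sum.inr v) = 𝒯 M (Sum.inr v))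
  (hP4 : ∀ (M c : ℕ) (dat : KolyvaginHeegnerData Dt β ι c),
    KolyvaginDescent.KolSupp (Zhang2014.IsKolyvaginPrime (W.conductorNorm ℤ) W K 2) c → 1 ≤ M →
    (∀ q ∈ c.primeFactors, M + 1 ≤ Zhang2014.kolyvaginIndex W 2 q) →
    ∀ w ∈ placesDividing K c,
      galoisCohomology.localization ((W.baseChange K).torsionGaloisModule ((2 ^ M : ℕ) : ℤ)) (Sum.inr w) 1
        (dat.kolyvaginClass Nat.prime_two M) ∈ 𝒯 M (Sum.inr w))
  (hP7n : ∀ (M M' ℓ : ℕ) (v : HeightOneSpectrum (𝓞 K))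
    (w C : galH1Torsion (W.baseChange K) ((2 ^ M : ℕ) : ℤ)) (s : ℤ) (b : ℕ),
    (s = 1 ∨ s = -1) → 1 ≤ M → Zhang2014.IsKolyvaginPrime (W.conductorNorm ℤ) W K 2 ℓ →
    M ≤ Zhang2014.kolyvaginIndex W 2 ℓ → M ≤ M' → FrobEqFrobInfty W K (2 ^ M') ℓ →
    ((ℓ : ℕ) : 𝓞 K) ∈ v.asIdeal →
    conjAct W τ ((2 ^ M : ℕ) : ℤ) C = s • C →
    galoisCohomology.localization ((W.baseChange K).torsionGaloisModule ((2 ^ M : ℕ) : ℤ)) (Sum.inr v) 1 w ∈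
      (W.baseChange K).kummerSelmerStructure ((2 ^ M : ℕ) : ℤ) (Sum.inr v) →
    (∀ j : ℕ, ((2 ^ j : ℕ) : ℤ) • galoisCohomology.localization ((W.baseChange K).torsionGaloisModule ((2 ^ M : ℕ) : ℤ))
      (Sum.inr v) 1 C ∈ (W.baseChange K).kummerSelmerStructure ((2 ^ M : ℕ) : ℤ) (Sum.inr v) ↔ b ≤ j) →
    localTatePairingZMod ((W.baseChange K).torsionGaloisModule ((2 ^ M : ℕ) : ℤ)) (2 ^ M) (Sum.inr v)
          (inv M (Sum.inr v))
          (galoisCohomology.localization ((W.baseChange K).torsionGaloisModule ((2 ^ M : ℕ) : ℤ)) (Sum.inr v) 1 w)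
          (galoisCohomology.localization (((W.baseChange K).torsionGaloisModule ((2 ^ M : ℕ) : ℤ)).tateDual (2 ^ M))
            (Sum.inr v) 1
            (galoisCohomology.map (weilDualIntertwining (W.baseChange K) (2 ^ M) (e M) (hμ M) (hadd₁ M) (hadd₂ M)
              (hgal M)) 1 C)) = 0 →
    ((2 ^ (M - b) : ℕ) : ℤ) •
      (galoisCohomology.localization ((W.baseChange K).torsionGaloisModule ((2 ^ M : ℕ) : ℤ)) (Sum.inr v) 1 w +
        s • galoisCohomology.localization ((W.baseChange K).torsionGaloisModule ((2 ^ M : ℕ) : ℤ)) (Sum.inr v) 1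
          (conjAct W τ ((2 ^ M : ℕ) : ℤ) w)) = 0)
  (hQ2 : KolyvaginRelationAtTwo)
  (hT2 : ∀ (n : ℕ) (d : KolyvaginHeegnerData Dt β ι n) (M : ℕ),
    KolyvaginDescent.KolSupp (Zhang2014.IsKolyvaginPrime (W.conductorNorm ℤ) W K 2) n →
    1 ≤ M → (M : ℕ∞) ≤ Zhang2014.levelIndex W 2 n →
    ∀ v : HeightOneSpectrum (𝓞 K), ((n : ℕ) : 𝓞 K) ∉ v.asIdeal →
      ((2 ^ 0 : ℕ) : ℤ) • d.kolyvaginClass Nat.prime_two M ∈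
        selmerLocalKer (W.baseChange K) (v.adicCompletion K) ((2 ^ M : ℕ) : ℤ))

include halt hnondeg hCM hΔ hsur hK hodd hne3 hns hHN hτ1 hperf hvan h𝒯sd hP4 hP7n hQ2 hT2 in
/-- **KOLYVAGIN'S FIRST SELMER ANNIHILATION AT `2`, NORM-SHARP core form.**  For a conductor-`1` datum `d₁` whose class `c_M(1)` has exact order
`2^g` (`g ≥ 1`), (NPh) at level `2^(M+k)` (`k ≥ 1`), and ANY Selmer class `z ∈ Sel_{2^M}(E/K)`: **`2^(M−g) • (z + w • τ_* z) = 0`**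
(`w = W.rootNumber`).  [cite: McCallumLMS1991, §5 (13), Lemma 5.3] [cite: GrossLMS1991, §8 Prop. 8.2, §10] [cite: Kolyvagin1991MathAnn, §2 Thm. 2.2] -/
theorem selmerLayerOne_core_norm {M k g : ℕ} (d₁ : KolyvaginHeegnerData Dt β ι 1)
    (hM : 1 ≤ M) (hk : 1 ≤ k) (hg : 1 ≤ g) (hord : addOrderOf (d₁.kolyvaginClass Nat.prime_two M) = 2 ^ g)
    (hNPh : ∀ z : galH1Torsion (W.baseChange K) ((2 ^ (M + k) : ℕ) : ℤ),
      (∀ ρ ∈ torsionFixing (W.baseChange K) ((2 ^ (M + k) : ℕ) : ℤ),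
        h1Eval (W.baseChange K) ((2 ^ (M + k) : ℕ) : ℤ) z ρ = 0) →
      (∀ w : HeightOneSpectrum (𝓞 K), ((2 * W.conductorNorm ℤ : ℕ) : 𝓞 K) ∈ w.asIdeal →
        z ∈ selmerLocalKer (W.baseChange K) (w.adicCompletion K) ((2 ^ (M + k) : ℕ) : ℤ)) → z = 0)
    (z : galH1Torsion (W.baseChange K) ((2 ^ M : ℕ) : ℤ))
    (hz : z ∈ selmerGroup (W.baseChange K) ((2 ^ M : ℕ) : ℤ)) :
    ((2 ^ (M - g) : ℕ) : ℤ) • (z + W.rootNumber • conjAct W τ ((2 ^ M : ℕ) : ℤ) z) = 0 := by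
  classical
  haveI : Fact (Nat.Prime 2) := ⟨Nat.prime_two⟩
  have hne4 : NumberField.discr K ≠ -4 := fun h ↦ by
    rw [h] at hodd; have := Int.odd_iff.mp hodd; omega
  have hD : NumberField.discr K < -4 := IsImaginaryQuadratic.discr_lt_neg_four_of_odd hK hodd hne3
  have hρ2 : W.HasSurjectiveModNGaloisRep 2 := by simpa using hsur 1
  have hsur1 : W.HasSurjectiveModNGaloisRep ((2 : ℤ) ^ 1) := by exact_mod_cast hsur 1
  have hττ : τ * τ = 1 := mul_self_eq_one_of_isImaginaryQuadratic hK τ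
  have hw : W.rootNumber = 1 ∨ W.rootNumber = -1 := W.rootNumber_eq_one_or
  by_contra H
  -- (0) the class `y' := 2^(M−g) • (z + w τ_* z)`: Selmer, sign `w`, exact order `2^u` with `u ≥ 1`
  set y := z + W.rootNumber • conjAct W τ ((2 ^ M : ℕ) : ℤ) z with hy_def
  set y' := ((2 ^ (M - g) : ℕ) : ℤ) • y with hy'_def
  have hyS : y ∈ selmerGroup (W.baseChange K) ((2 ^ M : ℕ) : ℤ) :=
    add_mem hz (AddSubgroup.zsmul_mem _ (conjAct_mem_selmerGroup W (fun u ↦ hK.2.isComplex u) τ _ hz) _)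
  have hy'S : y' ∈ selmerGroup (W.baseChange K) ((2 ^ M : ℕ) : ℤ) := AddSubgroup.zsmul_mem _ hyS _
  have hyτ : conjAct W τ ((2 ^ M : ℕ) : ℤ) y = W.rootNumber • y := by
    have h1 : conjAct W τ ((2 ^ M : ℕ) : ℤ) y =
        conjAct W τ ((2 ^ M : ℕ) : ℤ) z + W.rootNumber • conjAct W τ ((2 ^ M : ℕ) : ℤ) (conjAct W τ ((2 ^ M : ℕ) : ℤ) z) := by
      rw [hy_def, map_add, map_zsmul]
    rw [h1, conjAct_conjAct_of_mul_self W hττ, hy_def]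
    rcases hw with h | h
    · simp only [h, one_zsmul]; abel
    · simp only [h, neg_one_zsmul]; abel
  have hy'τ : conjAct W τ ((2 ^ M : ℕ) : ℤ) y' = W.rootNumber • y' := by
    rw [hy'_def, map_zsmul, hyτ, smul_comm]
  have hMy' : ((2 ^ M : ℕ) : ℤ) • y' = 0 := zsmul_galH1Torsion_eq_zero (W.baseChange K) _ y'
  obtain ⟨u, hru, huM, hu0, hu1⟩ := exists_two_pow_orderExp_swap y' hMy' (r := 0)
    (by rwa [pow_zero, Nat.cast_one, one_zsmul])
  have hu_one : 1 ≤ u := by omega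
  have hy'u : addOrderOf y' = 2 ^ u := addOrderOf_eq_two_pow_of_zsmul_swap hu_one hu0 hu1
  -- (1) the conductor-`1` class `c = c_M(1)`: order `2^g`, `g ≤ M`, sign `−w`
  set c := d₁.kolyvaginClass Nat.prime_two M with hc_def
  have hMc : ((2 ^ M : ℕ) : ℤ) • c = 0 := zsmul_galH1Torsion_eq_zero _ _ _
  have hjc : ((2 ^ (g - 1) : ℕ) : ℤ) • c ≠ 0 := fun h ↦ by
    have hdvd := addOrderOf_dvd_of_nsmul_eq_zero ((natCast_zsmul c (2 ^ (g - 1))).symm.trans h)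
    rw [hord, Nat.pow_dvd_pow_iff_le_right (by norm_num)] at hdvd; omega
  have hgM : g ≤ M := by
    by_contra h
    exact hjc (two_pow_zsmul_eq_zero_of_le_swap (by omega) hMc)
  have h1K : ∀ p ∈ (1 : ℕ).primeFactors, Zhang2014.IsKolyvaginPrime (W.conductorNorm ℤ) W K 2 p ∧
      M ≤ Zhang2014.kolyvaginIndex W 2 p := fun p hp ↦ by simp at hp
  obtain ⟨hε1, hcsign⟩ := KolyvaginClassSign.sign_conjAct_kolyvaginClass_two hK hne3 hne4 hodd hHN hsur1 τ hτ1
    Dt β ι squarefree_one hM h1K d₁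
  simp only [Nat.primeFactors_one, Finset.card_empty, pow_zero, mul_one] at hε1 hcsign
  -- (2) Selmer memberships at the finite places (for the (NPh) separation and the reciprocity)
  have h1Kol : KolyvaginDescent.KolSupp (Zhang2014.IsKolyvaginPrime (W.conductorNorm ℤ) W K 2) 1 :=
    ⟨squarefree_one, fun q hq ↦ by simp at hq⟩
  have h1lev : (M : ℕ∞) ≤ Zhang2014.levelIndex W 2 1 :=
    Zhang2014.natCast_le_levelIndex_iff.mpr fun q hq ↦ by simp at hq
  have hcSel : ∀ w' : HeightOneSpectrum (𝓞 K),
      c ∈ selmerLocalKer (W.baseChange K) (w'.adicCompletion K) ((2 ^ M : ℕ) : ℤ) := by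
    intro w'
    have h1w' : ((1 : ℕ) : 𝓞 K) ∉ w'.asIdeal := by
      rw [Nat.cast_one]; exact fun h ↦ w'.isPrime.ne_top ((Ideal.eq_top_iff_one _).mpr h)
    have h := hT2 1 d₁ M h1Kol hM h1lev w' h1w'
    rwa [pow_zero, Nat.cast_one, one_zsmul] at h
  have hy'Sel : ∀ w' : HeightOneSpectrum (𝓞 K),
      y' ∈ selmerLocalKer (W.baseChange K) (w'.adicCompletion K) ((2 ^ M : ℕ) : ℤ) := fun w' ↦
    ((mem_selmerGroup_iff (W.baseChange K) _ y').mp hy'S).1 w'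
  have hzF : z ∈ (selmerF W ((2 ^ M : ℕ) : ℤ) (𝒯 M) (placesDividing K 1)).selmerGroup := by
    rw [placesDividing_one, selmerF_empty, ← selmerGroup_eq_selmerGroup_kummerSelmerStructure]
    exact hz
  have hzKum : ∀ w' : HeightOneSpectrum (𝓞 K),
      galoisCohomology.localization ((W.baseChange K).torsionGaloisModule ((2 ^ M : ℕ) : ℤ)) (Sum.inr w') 1 z ∈
        (W.baseChange K).kummerSelmerStructure ((2 ^ M : ℕ) : ℤ) (Sum.inr w') := fun w' ↦
    (mem_selmerLocalKer_two_pow_iff W M w' z).mp (((mem_selmerGroup_iff (W.baseChange K) _ z).mp hz).1 w')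
  -- (3) the deep pair Čebotarev for `(c_M(1), y')`
  have hdvd := natCast_pow_dvd_natCast_pow_add 2 M k
  have hιinj : Function.Injective (torsionH1OfDvd (W.baseChange K) hdvd) :=
    torsionH1OfDvd_two_pow_injective W K hK hρ2 M k
  have hinf := infinite_kolyvaginPrime_localization_fullOrder_pair_deep W K hCM hΔ hK hns hsur τ hτ1 M k hM c y'
    hg hu_one hord hy'u hε1 hw hcsign hy'τ (fun a' b' hab ↦ by
      have hz0 := hNPh _ hab fun w' hw' ↦
        (RelaxedCount.torsionH1OfDvd_mem_selmerLocalKer_iff_mem (W.baseChange K) hdvd (w'.adicCompletion K) _).mpr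
          (add_mem (AddSubgroup.zsmul_mem _ (hcSel w') a') (AddSubgroup.zsmul_mem _ (hy'Sel w') b'))
      exact hιinj (by rw [hz0, map_zero]))
  obtain ⟨ℓ, hℓmem⟩ := hinf.nonempty
  obtain ⟨hfrob, hKolℓ, hIℓ, hlocℓ⟩ := hℓmem
  have hℓp : ℓ.Prime := hKolℓ.1
  have hℓ0 : ℓ ≠ 0 := hℓp.ne_zero
  have hℓ1 : ℓ ∉ (1 : ℕ).primeFactors := by simp
  have hℓdvd : ¬ ℓ ∣ 1 := fun h ↦ hℓp.ne_one (Nat.dvd_one.mp h)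
  have hMℓ : M ≤ Zhang2014.kolyvaginIndex W 2 ℓ := le_trans (by omega) hIℓ
  have hM1ℓ : M + 1 ≤ Zhang2014.kolyvaginIndex W 2 ℓ := le_trans (by omega) hIℓ
  obtain ⟨v', hv'⟩ : ∃ v : HeightOneSpectrum (𝓞 K), ((ℓ : ℕ) : 𝓞 K) ∈ v.asIdeal :=
    ⟨⟨Ideal.span {((ℓ : ℕ) : 𝓞 K)}, hKolℓ.2.2.2.2.1, by
        rw [Ne, Ideal.span_singleton_eq_bot]; exact_mod_cast hℓp.ne_zero⟩,
      Ideal.mem_span_singleton_self _⟩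
  obtain ⟨hcloc, hy'loc⟩ := hlocℓ v' hv'
  -- (4) a datum of conductor `1 · ℓ` compatible with `d₁`, its class `C = c_M(ℓ)`: sign `w`, `C ∈ H¹_{𝓕(ℓ)}`
  obtain ⟨dℓ, hdℓ⟩ := JET.exists_compatible_data_of_grossCM (N := W.conductorNorm ℤ)
    (phi_heegnerPointOfConductor_mem_range_map_ringClassField_holds (W.conductorNorm ℤ) W K) hK hD hHN 2 Dt β ι
    squarefree_one (fun q hq ↦ by simp at hq) d₁
  obtain ⟨hσ, hS, hS', hemb⟩ := hdℓ ℓ hKolℓ hℓ1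
  set d' := dℓ ℓ hKolℓ hℓ1 with hd'_def
  have hN : Squarefree (1 * ℓ) := by rw [one_mul]; exact hℓp.squarefree
  have hN0 : 1 * ℓ ≠ 0 := hN.ne_zero
  have hNpf : (1 * ℓ).primeFactors = {ℓ} := by rw [one_mul, hℓp.primeFactors]
  have hNK : ∀ q ∈ (1 * ℓ).primeFactors, Zhang2014.IsKolyvaginPrime (W.conductorNorm ℤ) W K 2 q ∧
      M + 1 ≤ Zhang2014.kolyvaginIndex W 2 q := by
    intro q hq
    rw [hNpf, Finset.mem_singleton] at hq
    subst hq
    exact ⟨hKolℓ, hM1ℓ⟩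
  have hNK' : ∀ q ∈ (1 * ℓ).primeFactors, Zhang2014.IsKolyvaginPrime (W.conductorNorm ℤ) W K 2 q ∧
      M ≤ Zhang2014.kolyvaginIndex W 2 q :=
    fun q hq ↦ ⟨(hNK q hq).1, Nat.le_of_succ_le (hNK q hq).2⟩
  have hNKol : KolyvaginDescent.KolSupp (Zhang2014.IsKolyvaginPrime (W.conductorNorm ℤ) W K 2) (1 * ℓ) :=
    ⟨hN, fun q hq ↦ (hNK q hq).1⟩
  set C := d'.kolyvaginClass Nat.prime_two M with hC_def
  obtain ⟨-, hCsign⟩ := KolyvaginClassSign.sign_conjAct_kolyvaginClass_two hK hne3 hne4 hodd hHN hsur1 τ hτ1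
    Dt β ι hN hM hNK' d'
  have hCsign' : conjAct W τ ((2 ^ M : ℕ) : ℤ) C = W.rootNumber • C := by
    rw [hC_def, hCsign, hNpf, Finset.card_singleton, pow_one]; ring_nf
  have hCF : C ∈ (selmerF W ((2 ^ M : ℕ) : ℤ) (𝒯 M) (placesDividing K (1 * ℓ))).selmerGroup := by
    have h := zsmul_kolyvaginClass_mem_selmerF W Dt β ι 𝒯 (hK := hK) (hP4 := hP4) (hT2 := hT2) d' hNKol hM
      (fun q hq ↦ (hNK q hq).2)
    rwa [pow_zero, Nat.cast_one, one_zsmul] at h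
  -- (5) ONE-term reciprocity at `v'`
  have hsum := sum_localTatePairing_eq_zero_of_dvd W 2 M (e M) (hμ M) (hadd₁ M) (hadd₂ M) (hgal M) (halt M)
    (hnondeg M) hK hM (inv M) (fun v ↦ ((hperf M) v).1.injective) (hvan M) (𝒯 M) hN0 (one_dvd _)
    (h𝒯sd M (1 * ℓ)) z C hzF hCF
  have hv'D : v' ∈ placesDividing K (1 * ℓ) \ placesDividing K 1 := by
    rw [Finset.mem_sdiff, placesDividing_one, mem_placesDividing_iff_natCast_mem hN0, Nat.cast_mul, Nat.cast_one, one_mul]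
    exact ⟨hv', by simp⟩
  have hDv : ∀ w ∈ placesDividing K (1 * ℓ) \ placesDividing K 1, w = v' := by
    intro w hw
    rw [Finset.mem_sdiff] at hw
    obtain ⟨q, hq, hqw⟩ := (natCast_mem_iff_exists_primeFactor_mem hN0 w).mp
      ((mem_placesDividing_iff_natCast_mem hN0 w).mp hw.1)
    rw [hNpf, Finset.mem_singleton] at hq
    subst hq
    exact Summit.BirchSwinnertonDyer.Rank1Residual.JET.Walk.place_eq_of_natCast_mem_of_isPrime hℓ0
      hKolℓ.2.2.2.2.1 w v' hqw hv'
  rw [Finset.sum_eq_single_of_mem v' hv'D (fun w hw hwv ↦ absurd (hDv w hw) hwv)] at hsum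
  -- (6) the Kummer threshold of `C` at `v'` is `g` (Q2 at the own prime `ℓ`, threshold of `c_M(1)` from the Čebotarev clause)
  have hQℓ := hQ2 W hCM K hK hne3 hne4 hHN hsur Dt β ι M hM 1 ℓ hN hℓp hℓdvd hNK' d₁ d' hσ hS hS' hemb v' hv'
  have hβC : ∀ j : ℕ, ((2 ^ j : ℕ) : ℤ) •
      galoisCohomology.localization ((W.baseChange K).torsionGaloisModule ((2 ^ M : ℕ) : ℤ)) (Sum.inr v') 1 C ∈
        (W.baseChange K).kummerSelmerStructure ((2 ^ M : ℕ) : ℤ) (Sum.inr v') ↔ g ≤ j := by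
    intro j
    refine Iff.trans ?_ (((hQℓ j).1.trans (hQℓ j).2).trans (hcloc j))
    refine Iff.trans ?_ (mem_selmerLocalKer_two_pow_iff W M v' _).symm
    exact ⟨fun h ↦ mem_of_eq_of_mem_swap h (map_zsmul _ _ _), fun h ↦ mem_of_eq_of_mem_swap h (map_zsmul _ _ _).symm⟩
  -- (7) the NORM law at `v'`: `loc y' = 0` — contradicting the Čebotarev clause for `y'`
  have hA := hP7n M (M + k) ℓ v' z C W.rootNumber g hw hM hKolℓ hMℓ (by omega) hfrob hv' hCsign' (hzKum v') hβC hsum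
  have hlocy : galoisCohomology.localization ((W.baseChange K).torsionGaloisModule ((2 ^ M : ℕ) : ℤ)) (Sum.inr v') 1 y =
      galoisCohomology.localization ((W.baseChange K).torsionGaloisModule ((2 ^ M : ℕ) : ℤ)) (Sum.inr v') 1 z +
        W.rootNumber • galoisCohomology.localization ((W.baseChange K).torsionGaloisModule ((2 ^ M : ℕ) : ℤ)) (Sum.inr v') 1
          (conjAct W τ ((2 ^ M : ℕ) : ℤ) z) :=
    (map_add (galoisCohomology.localization ((W.baseChange K).torsionGaloisModule ((2 ^ M : ℕ) : ℤ)) (Sum.inr v') 1) z _).trans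
      (congrArg (fun t ↦ galoisCohomology.localization ((W.baseChange K).torsionGaloisModule ((2 ^ M : ℕ) : ℤ)) (Sum.inr v') 1 z + t)
        (map_zsmul (galoisCohomology.localization ((W.baseChange K).torsionGaloisModule ((2 ^ M : ℕ) : ℤ)) (Sum.inr v') 1)
          W.rootNumber (conjAct W τ ((2 ^ M : ℕ) : ℤ) z)))
  have hlocy' : galoisCohomology.localization ((W.baseChange K).torsionGaloisModule ((2 ^ M : ℕ) : ℤ)) (Sum.inr v') 1 y' = 0 :=
    (map_zsmul (galoisCohomology.localization ((W.baseChange K).torsionGaloisModule ((2 ^ M : ℕ) : ℤ)) (Sum.inr v') 1)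
      (((2 ^ (M - g) : ℕ) : ℤ)) y).trans ((congrArg (fun t ↦ ((2 ^ (M - g) : ℕ) : ℤ) • t) hlocy).trans hA)
  have hker : y' ∈ (W.baseChange K).torsionLocalKer (v'.adicCompletion K) ((2 ^ M : ℕ) : ℤ) :=
    (mem_torsionLocalKer_two_pow_iff W M v' y').mpr hlocy'
  have h0 := (hy'loc 0).mp (by rwa [pow_zero, Nat.cast_one, one_zsmul])
  omega

end Frame

/-! ## §2 The NORM slot `hP7n` DISCHARGED from gk2-p3 g25's local law (p741749) -/

section NormLaw

variable {K : Type} [Field K] [NumberField K] (W : WeierstrassCurve ℚ) [W.IsElliptic]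
  [W.IsGloballyMinimal] [(W.baseChange K).IsElliptic]
  [∀ M : ℕ, NeZero (2 ^ M)] [∀ M : ℕ, Finite (geomTorsion (W.baseChange K) ((2 ^ M : ℕ) : ℤ))]
  (τ : K ≃ₐ[ℚ] K)
  (e : ∀ M : ℕ, geomTorsion (W.baseChange K) ((2 ^ M : ℕ) : ℤ) →
    geomTorsion (W.baseChange K) ((2 ^ M : ℕ) : ℤ) → AlgebraicClosure K)
  (hμ : ∀ M S T, e M S T ^ (2 ^ M) = 1)
  (hadd₁ : ∀ M S₁ S₂ T, e M (S₁ + S₂) T = e M S₁ T * e M S₂ T)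
  (hadd₂ : ∀ M S T₁ T₂, e M S (T₁ + T₂) = e M S T₁ * e M S T₂)
  (hgal : ∀ M (g : absoluteGaloisGroup K) (S T : geomTorsion (W.baseChange K) ((2 ^ M : ℕ) : ℤ)),
    g • e M S T = e M (g • S) (g • T))
  (halt : ∀ M T, e M T T = 1) (hnondeg : ∀ M T, (∀ S, e M S T = 1) → T = 0)
  (hτe : ∀ (M : ℕ) S T, liftAut τ (e M S T) =
    e M ((isLiftOfAut_liftAut τ).torsionMap W ((2 ^ M : ℕ) : ℤ) S)
      ((isLiftOfAut_liftAut τ).torsionMap W ((2 ^ M : ℕ) : ℤ) T))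
  (inv : ∀ M : ℕ, LocalInvariants K (2 ^ M))
  (hK : IsImaginaryQuadratic K) (hΔ : W.Δ < 0) (hτ1 : τ ≠ 1)
  (hperf : ∀ M, (inv M).IsPerfect) (hinvc : ∀ M, (inv M).IsConjCompatible τ)

include hμ hadd₁ hadd₂ hgal halt hnondeg hτe hK hΔ hτ1 hperf hinvc in
/-- **The norm slot `hP7n`, DISCHARGED** — gk2-p3 g25's `two_pow_smul_localization_norm_eq_zero_of_invWeilPairing_eq_zero` (p741749) moved to the
PT-family / Weil-transport currency of the swap cores: at a Kolyvagin place `λ ∋ ℓ` of index `≥ M` with `Frob_ℓ = Frob_∞` on `K(E[2^M′])`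
(`M ≤ M′`), for `w` Kummer at `λ` and an `s`-eigen class `C` whose Kummer threshold at `λ` is `b`: if `⟨loc w, loc w_* C⟩_λ = 0` then
**`2^(M−b) • (loc w + s • loc τ_* w) = 0`** (bridge: `invWeilPairing_apply`, `X11b.LocBridge.localTatePairingZMod_map_weilDual`,
`galoisCohomology.res_map_one`, `conjActPlace_localization`, `weil_equivariant_of_isLiftOfAut`).
[cite: McCallumLMS1991, §5 (13), Lemma 5.3] [cite: GrossLMS1991, §8 Prop. 8.2] -/
theorem normLaw_sharp_at_two :
    ∀ (M M' ℓ : ℕ) (v : HeightOneSpectrum (𝓞 K))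
    (w C : galH1Torsion (W.baseChange K) ((2 ^ M : ℕ) : ℤ)) (s : ℤ) (b : ℕ),
    (s = 1 ∨ s = -1) → 1 ≤ M → Zhang2014.IsKolyvaginPrime (W.conductorNorm ℤ) W K 2 ℓ →
    M ≤ Zhang2014.kolyvaginIndex W 2 ℓ → M ≤ M' → FrobEqFrobInfty W K (2 ^ M') ℓ →
    ((ℓ : ℕ) : 𝓞 K) ∈ v.asIdeal →
    conjAct W τ ((2 ^ M : ℕ) : ℤ) C = s • C →
    galoisCohomology.localization ((W.baseChange K).torsionGaloisModule ((2 ^ M : ℕ) : ℤ)) (Sum.inr v) 1 w ∈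
      (W.baseChange K).kummerSelmerStructure ((2 ^ M : ℕ) : ℤ) (Sum.inr v) →
    (∀ j : ℕ, ((2 ^ j : ℕ) : ℤ) • galoisCohomology.localization ((W.baseChange K).torsionGaloisModule ((2 ^ M : ℕ) : ℤ))
      (Sum.inr v) 1 C ∈ (W.baseChange K).kummerSelmerStructure ((2 ^ M : ℕ) : ℤ) (Sum.inr v) ↔ b ≤ j) →
    localTatePairingZMod ((W.baseChange K).torsionGaloisModule ((2 ^ M : ℕ) : ℤ)) (2 ^ M) (Sum.inr v)
          (inv M (Sum.inr v))
          (galoisCohomology.localization ((W.baseChange K).torsionGaloisModule ((2 ^ M : ℕ) : ℤ)) (Sum.inr v) 1 w)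
          (galoisCohomology.localization (((W.baseChange K).torsionGaloisModule ((2 ^ M : ℕ) : ℤ)).tateDual (2 ^ M))
            (Sum.inr v) 1
            (galoisCohomology.map (weilDualIntertwining (W.baseChange K) (2 ^ M) (e M) (hμ M) (hadd₁ M) (hadd₂ M)
              (hgal M)) 1 C)) = 0 →
    ((2 ^ (M - b) : ℕ) : ℤ) •
      (galoisCohomology.localization ((W.baseChange K).torsionGaloisModule ((2 ^ M : ℕ) : ℤ)) (Sum.inr v) 1 w +
        s • galoisCohomology.localization ((W.baseChange K).torsionGaloisModule ((2 ^ M : ℕ) : ℤ)) (Sum.inr v) 1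
          (conjAct W τ ((2 ^ M : ℕ) : ℤ) w)) = 0 := by
  intro M M' ℓ v w C s b hs hM1 hKol hMℓ hMM' hF hv hCτ hwK hβ h0
  classical
  haveI : Fact (Nat.Prime 2) := ⟨Nat.prime_two⟩
  have hℓ0 : ℓ ≠ 0 := hKol.1.ne_zero
  have hfix : τ • v = v := smul_place_eq_self_of_natCast_mem τ hℓ0 hKol.2.2.2.2.1 v hv
  have hττ : τ * τ = 1 := mul_self_eq_one_of_isImaginaryQuadratic hK τ
  have hinj : ∀ (M : ℕ) (v : HeightOneSpectrum (𝓞 K)), Injective (inv M (Sum.inr v)) :=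
    fun M v ↦ ((hperf M) v).1.injective
  have hte' : ∀ S T, e M ((isLiftOfAut_liftAutPlace τ hfix).torsionMap W ((2 ^ M : ℕ) : ℤ) S)
      ((isLiftOfAut_liftAutPlace τ hfix).torsionMap W ((2 ^ M : ℕ) : ℤ) T) = liftAutPlace τ hfix (e M S T) := fun S T ↦
    (weil_equivariant_of_isLiftOfAut W ((2 ^ M : ℕ) : ℤ) (isLiftOfAut_liftAutPlace τ hfix) (isLiftOfAut_liftAut τ)
      (e M) (hgal M) (hτe M) S T).symm
  have hF' : FrobEqFrobInfty W K (2 ^ M) ℓ := hF.of_dvd (pow_dvd_pow 2 hMM')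
  have hβ' : ∀ j : ℕ, (2 ^ j) • galoisCohomology.localization ((W.baseChange K).torsionGaloisModule ((2 ^ M : ℕ) : ℤ))
      (Sum.inr v) 1 C ∈ (W.baseChange K).kummerSelmerStructure ((2 ^ M : ℕ) : ℤ) (Sum.inr v) ↔ b ≤ j := fun j ↦ by
    rw [← natCast_zsmul]; exact hβ j
  -- the pairing value in the `invWeilPairing` currency of p741749
  have hnat : galoisCohomology.map ((weilDualIntertwining (W.baseChange K) (2 ^ M) (e M) (hμ M) (hadd₁ M)
      (hadd₂ M) (hgal M)).restrictField (Place.Completion (Sum.inr v : Place K))) 1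
      (galoisCohomology.localization ((W.baseChange K).torsionGaloisModule ((2 ^ M : ℕ) : ℤ)) (Sum.inr v) 1 C) =
      galoisCohomology.localization (((W.baseChange K).torsionGaloisModule ((2 ^ M : ℕ) : ℤ)).tateDual (2 ^ M)) (Sum.inr v) 1
        (galoisCohomology.map (weilDualIntertwining (W.baseChange K) (2 ^ M) (e M) (hμ M) (hadd₁ M) (hadd₂ M) (hgal M)) 1 C) :=
    (galoisCohomology.res_map_one (Place.Completion (Sum.inr v : Place K))
      (weilDualIntertwining (W.baseChange K) (2 ^ M) (e M) (hμ M) (hadd₁ M) (hadd₂ M) (hgal M))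
      (C : galoisCohomology ((W.baseChange K).torsionGaloisModule ((2 ^ M : ℕ) : ℤ)) 1)).symm
  have h0' : invWeilPairing (W.baseChange K) (2 ^ M) (e M) (hμ M) (hadd₁ M) (hadd₂ M) (hgal M) (inv M) (Sum.inr v)
      (galoisCohomology.localization ((W.baseChange K).torsionGaloisModule ((2 ^ M : ℕ) : ℤ)) (Sum.inr v) 1 w)
      (galoisCohomology.localization ((W.baseChange K).torsionGaloisModule ((2 ^ M : ℕ) : ℤ)) (Sum.inr v) 1 C) = 0 := by
    rw [invWeilPairing_apply, ← X11b.LocBridge.localTatePairingZMod_map_weilDual, hnat]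
    exact h0
  have key := two_pow_smul_localization_norm_eq_zero_of_invWeilPairing_eq_zero W K hK hΔ hM1 hKol hMℓ hF' v hv hτ1 hττ hfix
    (e M) (hμ M) (hadd₁ M) (hadd₂ M) (hgal M) (halt M) (hnondeg M) hte' (inv M) (hinj M v) (hinvc M) hs hCτ hwK hβ' h0'
  rw [conjActPlace_localization, ← natCast_zsmul] at key
  exact key

end NormLaw

end Summit.BirchSwinnertonDyer.BirchSwinnertonDyer.Theorems.GenusExact.PlusDescent

end
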